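import Summits.RiemannHypothesis.RiemannHypothesis.Theorems.GroundBartaPolarPerronFrobeniusThetaWindowCollarBound
import Mathlib.Analysis.Complex.ExponentialBounds
import HarnessLib

/-!
# The collar estimate II: archimedean term and the bound `‖W(τ_u κ_a)‖ ≤ C x^p e^{−πx}`
(route `RiemannHypothesis/GroundBarta`, rung 3 `PolarPerronFrobenius`, stmt-RiemannHypothesis-18390 —
theta-vector toolkit; analytic content of item `ThetaWindowImage`, stmt-RiemannHypothesis-19848)

For `a ≥ 2`, `|u| ≤ a`, the translate `f = κ_a(· + u)` of the collar tail lies in the exponential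
Weil class, so its archimedean term is Bombieri's
`−[(log 4π + γ) f(0) + ∫₀^∞ (e^{t/2}(f(t) + f(−t)) − 2f(0))/(2 sinh t) dt]`; with
`sup κ_a ≤ S₀ = K₀ x^{9/4}e^{−πx}` and `sup|κ_a′| ≤ S₁ = K₁ x^{13/4}e^{−πx}` the integrand is
`≤ S₀ + S₁` on `(0,1]` (mean value theorem, `e^{t/2} − 1 ≤ t`, `sinh t ≥ t`) and `≤ 8S₀e^{−t/2}` on
`(1,∞)` (`2 sinh t ≥ e^t/2`), whence `‖arch(τ_u κ_a)‖ ≤ (log 4π + γ)S₀ + 2e^{1/2}(9S₀ + S₁)`.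
Together with the polar and prime bounds (part I):

  `‖W(τ_u κ_a)‖ ≤ C · x^{9/4 + β} · e^{−πx}`,  `β = 2π − 9/2`, `x = e^{2a}`
  (`exists_weilFunctional_translate_collarTail_le`),

and, by `thetaWindowImage_of_translate_bound`, the statement of item `ThetaWindowImage` (token for
token; `thetaWindowImage_statement`).  RH-free.  References: Bombieri 2000 Thm 2.
-/

set_option linter.dupNamespace false

noncomputable section

open Set MeasureTheory Filter Complex
open scoped Real Topology ComplexConjugate

namespace Summit.RiemannHypothesis.RiemannHypothesis.Theorems.PolarPerronFrobenius

open Literature.NumberTheory.LFunctions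
open Summit.RiemannHypothesis.RiemannHypothesis.Theorems.GroundBartaFloor
open Summit.RiemannHypothesis.RiemannHypothesis.Theorems.GroundStatesConvergeToXi

/-- The real collar tail `κ_a = Φ (1 - χ_a)`. -/
local notation "κr[" a "]" => (fun t : ℝ =>
  weilThetaPhi t * (1 - Real.smoothTransition ((a - t) * Real.exp (2 * a)) *
    Real.smoothTransition ((a + t) * Real.exp (2 * a))))

/-- The collar tail `κ_a = Φ (1 - χ_a)`, complexified. -/
local notation "κ[" a "]" => (fun t : ℝ =>
  ((weilThetaPhi t * (1 - Real.smoothTransition ((a - t) * Real.exp (2 * a)) *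
    Real.smoothTransition ((a + t) * Real.exp (2 * a))) : ℝ) : ℂ))

/-! ## Elementary inequalities -/

/-- `e^{t/2} − 1 ≤ t` for `0 ≤ t ≤ 1`. [folklore] -/
theorem exp_half_sub_one_le {t : ℝ} (ht0 : 0 ≤ t) (ht1 : t ≤ 1) : rexp (t / 2) - 1 ≤ t := by
  -- `e^y − 1 ≤ y e^y` (from `e^{−y} ≥ 1 − y`) and `e^{1/2} ≤ 2`
  have h1 : 1 - t / 2 ≤ rexp (-(t / 2)) := by linarith [Real.add_one_le_exp (-(t / 2))]
  have h2 : rexp (t / 2) * rexp (-(t / 2)) = 1 := by rw [← Real.exp_add]; simp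
  have h3 : rexp (t / 2) ≤ rexp (1 / 2) := Real.exp_le_exp.2 (by linarith)
  have h4 : rexp (1 / 2) ≤ 2 := by
    have h5 : rexp (1 / 2) * rexp (1 / 2) = rexp 1 := by rw [← Real.exp_add]; norm_num
    nlinarith [Real.exp_one_lt_d9, Real.exp_pos (1 / 2 : ℝ)]
  nlinarith [Real.exp_pos (t / 2), Real.exp_pos (-(t / 2))]

/-- `2 sinh t ≥ 2t` for `t ≥ 0` and `2 sinh t ≥ e^t / 2` for `t ≥ 1`. [folklore] -/
theorem two_sinh_lower {t : ℝ} (ht : 0 ≤ t) :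
    2 * t ≤ 2 * Real.sinh t ∧ (1 ≤ t → rexp t / 2 ≤ 2 * Real.sinh t) := by
  refine ⟨by linarith [Real.self_le_sinh_iff.2 ht], fun h1 => ?_⟩
  rw [Real.sinh_eq]
  have h2 : rexp (-t) ≤ rexp (-1) := Real.exp_le_exp.2 (by linarith)
  have h3 : rexp (-1) ≤ 1 / 2 := by
    have h4 : rexp (-1) * rexp 1 = 1 := by rw [← Real.exp_add]; simp
    nlinarith [Real.exp_one_gt_two, Real.exp_pos (-1 : ℝ)]
  have h5 : 2 ≤ rexp t := by
    have := Real.exp_le_exp.2 h1; linarith [Real.exp_one_gt_two]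
  linarith

/-! ## The archimedean term of the translated collar tail -/

set_option maxHeartbeats 800000 in
/-- **Archimedean term of the translated collar tail**: there is `K ≥ 0` such that for `a ≥ 2` and
`|u| ≤ a`, `‖arch(τ_u κ_a)‖ ≤ K x^{13/4} e^{−πx}` (`x = e^{2a}`). [cite: Bombieri2000Weil, Thm 2] -/
theorem exists_collarTail_arch_le :
    ∃ K : ℝ, 0 ≤ K ∧ ∀ a : ℝ, 2 ≤ a → ∀ u : ℝ, |u| ≤ a →
      ‖weilArchTerm (fun t => κ[a] (t + u))‖ ≤ K * rexp (2 * a) ^ (13 / 4 : ℝ) * rexp (-(π * rexp (2 * a))) := by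
  obtain ⟨K₁, hK₁0, hK₁⟩ := exists_collarTail_deriv_le
  have hφ := phiUpper_pos
  set K₀ : ℝ := 2 * phiUpper * rexp (2 * π) with hK₀
  have hK₀0 : 0 ≤ K₀ := by positivity
  set cγ : ℝ := Real.log (4 * π) + Real.eulerMascheroniConstant with hcγ
  have hcγ0 : 0 ≤ cγ := by
    have h1 : 0 ≤ Real.log (4 * π) := Real.log_nonneg (by nlinarith [Real.pi_gt_three])
    have h2 := Real.one_half_lt_eulerMascheroniConstant
    rw [hcγ]; linarith
  refine ⟨cγ * K₀ + 2 * rexp (1 / 2) * (9 * K₀ + K₁), by positivity, fun a ha u hu => ?_⟩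
  set x : ℝ := rexp (2 * a) with hx
  have hx1 : 1 ≤ x := Real.one_le_exp (by linarith)
  set R : ℝ := rexp (-(π * x)) with hR
  have hR0 : 0 < R := Real.exp_pos _
  -- the two suprema
  set S₀ : ℝ := K₀ * x ^ (9 / 4 : ℝ) * R with hS₀
  set S₁ : ℝ := K₁ * x ^ (13 / 4 : ℝ) * R with hS₁
  have hS₀0 : 0 ≤ S₀ := by positivity
  have hS₁0 : 0 ≤ S₁ := by positivity
  have hsup : ∀ s, 0 ≤ κr[a] s ∧ κr[a] s ≤ S₀ := fun s => by
    obtain ⟨h0, -, -, h3⟩ := collarTail_values ha s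
    exact ⟨h0, h3.trans (le_of_eq (by rw [hS₀, hK₀]))⟩
  have hder : ∀ s, |deriv κr[a] s| ≤ S₁ := fun s => (hK₁ a ha s).trans (le_of_eq (by rw [hS₁]))
  have hdiff : ∀ s, DifferentiableAt ℝ κr[a] s := fun s => (hasDerivAt_collarTail a s).differentiableAt
  have hMVT : ∀ s t : ℝ, |κr[a] t - κr[a] s| ≤ S₁ * |t - s| := fun s t => by
    have h := Convex.norm_image_sub_le_of_norm_deriv_le (f := κr[a]) (s := univ)
      (fun y _ => hdiff y) (fun y _ => by rw [Real.norm_eq_abs]; exact hder y) convex_univ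
      (mem_univ s) (mem_univ t)
    simpa only [Real.norm_eq_abs] using h
  -- `f = τ_u κ_a` is in the exponential class: Bombieri's form applies
  obtain ⟨hκc, hκb⟩ := thetaWin_tail_class a
  have hfc : ContDiff ℝ (⊤ : ℕ∞) (fun t : ℝ => κ[a] (t + u)) := hκc.comp (contDiff_id.add contDiff_const)
  have hfb := twi_envelope_translate hκb u
  obtain ⟨Cf, hf0, hf1, hf2⟩ := hExt_deriv_bounds_of_all hfb
  rw [← weilArchTermBombieri_eq_weilArchTerm_expClass hfc (by norm_num : (1 : ℝ) / 2 < 1) hf0 hf1 hf2,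
    weilArchTermBombieri]
  -- real form of the translate
  set fr : ℝ → ℝ := fun t => κr[a] (t + u) with hfr
  have hfre : ∀ t, κ[a] (t + u) = ((fr t : ℝ) : ℂ) := fun t => by simp only [hfr]
  have hfr0 : ∀ t, 0 ≤ fr t := fun t => (hsup _).1
  have hfrS : ∀ t, fr t ≤ S₀ := fun t => (hsup _).2
  have hfrL : ∀ t, |fr t - fr 0| ≤ S₁ * |t| := fun t => by
    have h := hMVT (0 + u) (t + u)
    simp only [hfr]
    rwa [show t + u - (0 + u) = t by ring] at h
  -- the integrand and its majorant
  set G : ℝ → ℂ := fun t => ((rexp (t / 2) : ℂ) * (κ[a] (t + u) + κ[a] (-t + u)) - 2 * κ[a] (0 + u)) /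
    (2 * Real.sinh t : ℂ) with hG
  set g : ℝ → ℝ := fun t => (9 * S₀ + S₁) * rexp (1 / 2) * rexp (-(1 / 2) * t) with hg
  have hGreal : ∀ t, G t = (((rexp (t / 2) * (fr t + fr (-t)) - 2 * fr 0) / (2 * Real.sinh t) : ℝ) : ℂ) := by
    intro t
    simp only [hG, hfre]
    push_cast
    ring_nf
  have hGle : ∀ t : ℝ, 0 < t → ‖G t‖ ≤ g t := by
    intro t ht
    rw [hGreal, Complex.norm_real, Real.norm_eq_abs]
    obtain ⟨hsinh1, hsinh2⟩ := two_sinh_lower ht.le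
    have hD : 0 < 2 * Real.sinh t := by linarith
    rw [abs_div, abs_of_pos hD, div_le_iff₀ hD]
    -- numerator decomposition
    have hN : |rexp (t / 2) * (fr t + fr (-t)) - 2 * fr 0| ≤
        (rexp (t / 2) - 1) * (fr t + fr (-t)) + |fr t - fr 0| + |fr (-t) - fr 0| := by
      have e : rexp (t / 2) * (fr t + fr (-t)) - 2 * fr 0 =
          (rexp (t / 2) - 1) * (fr t + fr (-t)) + ((fr t - fr 0) + (fr (-t) - fr 0)) := by ring
      rw [e]
      have h1 : 0 ≤ (rexp (t / 2) - 1) * (fr t + fr (-t)) :=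
        mul_nonneg (by linarith [Real.one_le_exp (show 0 ≤ t / 2 by linarith)])
          (add_nonneg (hfr0 _) (hfr0 _))
      calc _ ≤ |(rexp (t / 2) - 1) * (fr t + fr (-t))| + |(fr t - fr 0) + (fr (-t) - fr 0)| := abs_add_le _ _
        _ ≤ _ := by rw [abs_of_nonneg h1, add_assoc]; gcongr; exact abs_add_le _ _
    have hL1 := hfrL t
    have hL2 := hfrL (-t)
    rw [abs_neg] at hL2
    rw [abs_of_pos ht] at hL1 hL2
    have hge1 : 1 ≤ rexp (1 / 2) * rexp (-(1 / 2) * t) ∨ 1 < t := by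
      rcases le_or_gt t 1 with h | h
      · left
        rw [← Real.exp_add]
        exact Real.one_le_exp (by linarith)
      · right; exact h
    rcases le_or_gt t 1 with ht1 | ht1
    · -- `(0,1]`: numerator `≤ 2t(S₀ + S₁)`, denominator `≥ 2t`
      have he := exp_half_sub_one_le ht.le ht1
      have hnum : |rexp (t / 2) * (fr t + fr (-t)) - 2 * fr 0| ≤ 2 * t * (S₀ + S₁) := by
        refine hN.trans ?_
        have h1 : (rexp (t / 2) - 1) * (fr t + fr (-t)) ≤ t * (S₀ + S₀) :=
          mul_le_mul he (add_le_add (hfrS _) (hfrS _)) (add_nonneg (hfr0 _) (hfr0 _)) ht.le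
        linarith
      have hg1 : S₀ + S₁ ≤ g t := by
        have h1 : 1 ≤ rexp (1 / 2) * rexp (-(1 / 2) * t) := by
          rw [← Real.exp_add]; exact Real.one_le_exp (by linarith)
        calc S₀ + S₁ ≤ (9 * S₀ + S₁) * 1 := by linarith
          _ ≤ (9 * S₀ + S₁) * (rexp (1 / 2) * rexp (-(1 / 2) * t)) :=
              mul_le_mul_of_nonneg_left h1 (by positivity)
          _ = g t := by simp only [hg]; ring
      calc |rexp (t / 2) * (fr t + fr (-t)) - 2 * fr 0| ≤ 2 * t * (S₀ + S₁) := hnum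
        _ = (S₀ + S₁) * (2 * t) := by ring
        _ ≤ (S₀ + S₁) * (2 * Real.sinh t) := mul_le_mul_of_nonneg_left hsinh1 (by positivity)
        _ ≤ g t * (2 * Real.sinh t) := mul_le_mul_of_nonneg_right hg1 hD.le
    · -- `(1,∞)`: numerator `≤ 4 S₀ e^{t/2}`, denominator `≥ e^t/2`
      have hnum : |rexp (t / 2) * (fr t + fr (-t)) - 2 * fr 0| ≤ 4 * S₀ * rexp (t / 2) := by
        have h1 : |rexp (t / 2) * (fr t + fr (-t))| ≤ rexp (t / 2) * (S₀ + S₀) := by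
          rw [abs_of_nonneg (mul_nonneg (Real.exp_pos _).le (add_nonneg (hfr0 _) (hfr0 _)))]
          exact mul_le_mul_of_nonneg_left (add_le_add (hfrS _) (hfrS _)) (Real.exp_pos _).le
        have h2 : |2 * fr 0| ≤ 2 * S₀ := by
          rw [abs_of_nonneg (by linarith [hfr0 0])]; linarith [hfrS 0]
        have h3 : 1 ≤ rexp (t / 2) := Real.one_le_exp (by linarith)
        calc _ ≤ |rexp (t / 2) * (fr t + fr (-t))| + |2 * fr 0| := abs_sub _ _
          _ ≤ rexp (t / 2) * (S₀ + S₀) + 2 * S₀ := add_le_add h1 h2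
          _ ≤ 4 * S₀ * rexp (t / 2) := by nlinarith
      have hsinh := hsinh2 ht1.le
      have hkey : 4 * S₀ * rexp (t / 2) ≤ (8 * S₀ * rexp (-(1 / 2) * t)) * (rexp t / 2) := by
        have e : rexp (-(1 / 2) * t) * rexp t = rexp (t / 2) := by
          rw [← Real.exp_add]; congr 1; ring
        have e2 : (8 * S₀ * rexp (-(1 / 2) * t)) * (rexp t / 2) = 4 * S₀ * (rexp (-(1 / 2) * t) * rexp t) := by
          ring
        rw [e2, e]
      have hg2 : 8 * S₀ * rexp (-(1 / 2) * t) ≤ g t := by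
        have h1 : 1 ≤ rexp (1 / 2 : ℝ) := Real.one_le_exp (by norm_num)
        have h2 : 8 * S₀ ≤ (9 * S₀ + S₁) * rexp (1 / 2) := by
          have h3 : 9 * S₀ + S₁ ≤ (9 * S₀ + S₁) * rexp (1 / 2) :=
            le_mul_of_one_le_right (by positivity) h1
          linarith
        calc 8 * S₀ * rexp (-(1 / 2) * t) ≤ (9 * S₀ + S₁) * rexp (1 / 2) * rexp (-(1 / 2) * t) :=
              mul_le_mul_of_nonneg_right h2 (Real.exp_pos _).le
          _ = g t := by simp only [hg]
      calc |rexp (t / 2) * (fr t + fr (-t)) - 2 * fr 0| ≤ 4 * S₀ * rexp (t / 2) := hnum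
        _ ≤ (8 * S₀ * rexp (-(1 / 2) * t)) * (rexp t / 2) := hkey
        _ ≤ (8 * S₀ * rexp (-(1 / 2) * t)) * (2 * Real.sinh t) :=
            mul_le_mul_of_nonneg_left hsinh (by positivity)
        _ ≤ g t * (2 * Real.sinh t) := mul_le_mul_of_nonneg_right hg2 hD.le
  -- the integral of the majorant
  have hgi : Integrable g (volume.restrict (Ioi 0)) :=
    ((exp_neg_integrableOn_Ioi 0 (by norm_num : (0 : ℝ) < 1 / 2)).const_mul
      ((9 * S₀ + S₁) * rexp (1 / 2))).congr (Eventually.of_forall fun t => by simp only [hg])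
  have hgint : ∫ t in Ioi (0 : ℝ), g t = (9 * S₀ + S₁) * rexp (1 / 2) * 2 := by
    simp only [hg]
    rw [integral_const_mul, integral_exp_mul_Ioi (by norm_num : -(1 / 2 : ℝ) < 0)]
    norm_num
  have hI : ‖∫ t in Ioi (0 : ℝ), G t‖ ≤ (9 * S₀ + S₁) * rexp (1 / 2) * 2 := by
    rw [← hgint]
    exact norm_integral_le_of_norm_le hgi
      ((ae_restrict_iff' measurableSet_Ioi).2 (Eventually.of_forall fun t ht => hGle t ht))
  -- assemble
  have hf0 : ‖κ[a] (0 + u)‖ ≤ S₀ := by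
    rw [hfre, Complex.norm_real, Real.norm_of_nonneg (hfr0 0)]; exact hfrS 0
  have hcγn : ‖(Real.log (4 * π) + Real.eulerMascheroniConstant : ℂ)‖ = cγ := by
    rw [show (Real.log (4 * π) + Real.eulerMascheroniConstant : ℂ) = ((cγ : ℝ) : ℂ) by
      rw [hcγ]; push_cast; ring, Complex.norm_real, Real.norm_of_nonneg hcγ0]
  have hx13 : x ^ (9 / 4 : ℝ) ≤ x ^ (13 / 4 : ℝ) := Real.rpow_le_rpow_of_exponent_le hx1 (by norm_num)
  have hS₀' : S₀ ≤ K₀ * x ^ (13 / 4 : ℝ) * R := by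
    rw [hS₀]; exact mul_le_mul_of_nonneg_right (mul_le_mul_of_nonneg_left hx13 hK₀0) hR0.le
  calc ‖-((Real.log (4 * π) + Real.eulerMascheroniConstant : ℂ) * κ[a] (0 + u) +
          ∫ t in Ioi (0 : ℝ), G t)‖
      ≤ ‖(Real.log (4 * π) + Real.eulerMascheroniConstant : ℂ) * κ[a] (0 + u)‖ +
          ‖∫ t in Ioi (0 : ℝ), G t‖ := by rw [norm_neg]; exact norm_add_le _ _
    _ ≤ cγ * S₀ + (9 * S₀ + S₁) * rexp (1 / 2) * 2 := by
        rw [norm_mul, hcγn]; exact add_le_add (mul_le_mul_of_nonneg_left hf0 hcγ0) hI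
    _ = cγ * S₀ + 2 * rexp (1 / 2) * (9 * S₀ + S₁) := by ring
    _ ≤ cγ * (K₀ * x ^ (13 / 4 : ℝ) * R) + 2 * rexp (1 / 2) * (9 * (K₀ * x ^ (13 / 4 : ℝ) * R) +
          K₁ * x ^ (13 / 4 : ℝ) * R) := by
        have h2 : 0 ≤ 2 * rexp (1 / 2 : ℝ) := by positivity
        have h3 : 9 * S₀ + S₁ ≤ 9 * (K₀ * x ^ (13 / 4 : ℝ) * R) + K₁ * x ^ (13 / 4 : ℝ) * R := by
          rw [hS₁]; linarith
        exact add_le_add (mul_le_mul_of_nonneg_left hS₀' hcγ0) (mul_le_mul_of_nonneg_left h3 h2)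
    _ = (cγ * K₀ + 2 * rexp (1 / 2) * (9 * K₀ + K₁)) * x ^ (13 / 4 : ℝ) * R := by ring

/-! ## The collar estimate and the window image of the smooth theta vector -/

/-- **The collar estimate**: there is `C ≥ 0` with `‖W(τ_u κ_a)‖ ≤ C x^{9/4+β} e^{−πx}` for all
`a ≥ 2`, `|u| ≤ a` (`x = e^{2a}`, `β = 2π − 9/2`): polar + prime + archimedean bounds.
[cite: Bombieri2000Weil, Thm 2] -/
theorem exists_weilFunctional_translate_collarTail_le :
    ∃ C : ℝ, 0 ≤ C ∧ ∀ a : ℝ, 2 ≤ a → ∀ u : ℝ, |u| ≤ a →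
      ‖weilFunctional (fun t => κ[a] (t + u))‖ ≤
        C * rexp (2 * a) ^ (9 / 4 + (2 * π - 9 / 2)) * rexp (-(π * rexp (2 * a))) := by
  obtain ⟨K, hK0, hK⟩ := exists_collarTail_arch_le
  have hφ := phiUpper_pos
  set β : ℝ := 2 * π - 9 / 2 with hβ
  have hβ1 : 1 ≤ β := by rw [hβ]; linarith [Real.pi_gt_three]
  set Z : ℝ := ∑' n : ℕ, (n : ℝ) ^ (1 / 2 - (2 * π - 9 / 2)) with hZ
  have hZ0 : 0 ≤ Z := tsum_nonneg fun n => by positivity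
  refine ⟨8 * phiUpper * rexp (2 * π) + 4 * phiUpper * rexp (2 * π) * Z + K, by positivity,
    fun a ha u hu => ?_⟩
  set x : ℝ := rexp (2 * a) with hx
  have hx1 : 1 ≤ x := Real.one_le_exp (by linarith)
  set R : ℝ := rexp (-(π * x)) with hR
  have hR0 : 0 < R := Real.exp_pos _
  have hP := collarTail_polar_le ha hu
  have hPr := collarTail_prime_le ha hu
  have hA := hK a ha u hu
  simp only [← hx, ← hR] at hP hPr hA
  have h11 : x ^ (11 / 4 : ℝ) ≤ x ^ (9 / 4 + β) :=
    Real.rpow_le_rpow_of_exponent_le hx1 (by linarith)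
  have h13 : x ^ (13 / 4 : ℝ) ≤ x ^ (9 / 4 + β) :=
    Real.rpow_le_rpow_of_exponent_le hx1 (by linarith)
  rw [weilFunctional]
  calc ‖weilPolarTerm (fun t => κ[a] (t + u)) - weilPrimeTerm (fun t => κ[a] (t + u)) +
        weilArchTerm (fun t => κ[a] (t + u))‖
      ≤ ‖weilPolarTerm (fun t => κ[a] (t + u))‖ + ‖weilPrimeTerm (fun t => κ[a] (t + u))‖ +
          ‖weilArchTerm (fun t => κ[a] (t + u))‖ :=
        (norm_add_le _ _).trans (by gcongr; exact norm_sub_le _ _)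
    _ ≤ 8 * phiUpper * rexp (2 * π) * x ^ (11 / 4 : ℝ) * R +
          4 * phiUpper * rexp (2 * π) * Z * x ^ (9 / 4 + β) * R + K * x ^ (13 / 4 : ℝ) * R :=
        add_le_add (add_le_add hP hPr) hA
    _ ≤ 8 * phiUpper * rexp (2 * π) * x ^ (9 / 4 + β) * R +
          4 * phiUpper * rexp (2 * π) * Z * x ^ (9 / 4 + β) * R + K * x ^ (9 / 4 + β) * R := by
        gcongr
    _ = (8 * phiUpper * rexp (2 * π) + 4 * phiUpper * rexp (2 * π) * Z + K) * x ^ (9 / 4 + β) * R := by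
        ring

/-- **Item `ThetaWindowImage` of the draft route `EvenThetaVisibilityPinning`
(stmt-RiemannHypothesis-19848), token for token**: there are `C, a₀` such that for every `a ≥ a₀`
the smooth theta window vector `Θ_a` is a Weil test whose even window image is represented by some
`T ∈ L²` with `‖T‖₂ ≤ C x^C e^{−πx}`, `x = e^{2a}` (reduction
`thetaWindowImage_of_translate_bound` + the collar estimate). [cite: Bombieri2000Weil, Thm 2] -/
theorem thetaWindowImage_statement :
    ∃ C a₀ : ℝ, ∀ a : ℝ, a₀ ≤ a → Literature.NumberTheory.LFunctions.IsWeilTest (fun t : ℝ => ((Literature.NumberTheory.LFunctions.weilThetaPhi t * Real.smoothTransition ((a - t) * Real.exp (2 * a)) * Real.smoothTransition ((a + t) * Real.exp (2 * a)) : ℝ) : ℂ)) ∧ ∃ T : ℝ → ℂ, MeasureTheory.MemLp T 2 ∧ Real.sqrt (∫ t, ‖T t‖ ^ 2) ≤ C * Real.exp (2 * a) ^ C * Real.exp (-(Real.pi * Real.exp (2 * a))) ∧ ∀ g : ℝ → ℂ, Literature.NumberTheory.LFunctions.IsWeilTest g → tsupport g ⊆ Set.Icc (-a) a → (∀ t,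 g (-t) = g t) → Literature.NumberTheory.LFunctions.weilFunctional (Literature.NumberTheory.LFunctions.weilConv g (Literature.NumberTheory.LFunctions.weilReflect (fun t : ℝ => ((Literature.NumberTheory.LFunctions.weilThetaPhi t * Real.smoothTransition ((a - t) * Real.exp (2 * a)) * Real.smoothTransition ((a + t) * Real.exp (2 * a)) : ℝ) : ℂ)))) = ∫ t, g t * (starRingEnd ℂ) (T t) := by
  obtain ⟨C, hC, hB⟩ := exists_weilFunctional_translate_collarTail_le
  exact thetaWindowImage_of_translate_bound (C := C) (p := 9 / 4 + (2 * π - 9 / 2)) (a₀ := 2) hC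
    (by norm_num) hB

end Summit.RiemannHypothesis.RiemannHypothesis.Theorems.PolarPerronFrobenius

end
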